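import Mathlib
import Summits.Ventures.HodgeRepro0.P1LatticeIndexTwoExactCore3

/-!
# P1LatticeIndexTwoExactHodge — D13's THEOREM A (proofs/P1-FermatLatticeClosure-v1.2.md l.4, DECLARED STATUS l.4789) at its
INDEX-2 degrees: the «L_M ⊆ H_M» half and the index AS AN INDEX — THE GENERAL LEMMAS (pub-hodge-repro0, p1 (g29), 2026-08-30),
the completion of the g28 artefact lean/P1LatticeIndexTwoExactCore1–3.lean + A–N.lean (STATUS l.11843).

Supporting artefact in the sense of ROUTE.md R-5 (finite combinatorics / exact arithmetic only; never the discharge of a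
Hodge-theoretic step; record-only).  THE OBJECTS, as the g28 artefact states them (lean/P1LatticeIndexTwoExactCore1.lean):
odd vectors s ∈ ℤ^{⌊(M−1)/2⌋} (the coordinate a ↔ the pair {a, M − a}; for M even the coordinate M/2 is taken modulo the
pair (M/2, M/2) = 2e_{M/2} ∈ L_M and is NOT a coordinate); H_M := the integer kernel of the weight constraints
Σₐ sₐ·(2·(t·a mod M) − M) = 0 over the units t of ℤ/M (`LinearMap.ker (Matrix.mulVecLin (conMat M units_M))`);
L_M := the ℤ-span of the odd vectors of ALL blocks of the level M (`IsBlock`, a predicate on multisets: every Hodge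
4-multiset, every Hodge 6-multiset that is the sum of two zero-sum triples, every σ_{p,i} of Aoki's full p-standard set).
The g28 artefact certifies `index_two_M : H_M ⊓ L_M = H_M ⊓ {s : χ_M(s) even}` and `witness_not_le_M` (a Hodge multiset
x_M with s(x_M) ∈ H_M and χ_M(s(x_M)) odd) — «H_M ⊓ L_M has index exactly 2 in H_M» — and leaves L_M ⊆ H_M (the page's
Lemma 1 (b)/(d) in its lattice form: every block is a Hodge multiset, whose odd vector satisfies every weight
constraint) NOT formalised.  THIS ARTEFACT closes that gap: [H_M : L_M] = 2 as an index.

THE GENERAL LEMMAS, for every M and n = ⌊(M−1)/2⌋: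
* `pointwise` / `sum_oddVec_mul_wvec` — THE WEIGHT IDENTITY: for a multiset x of entries in [1, M−1] and a unit t,
  Σₐ s(x)ₐ·(2·(t·(a+1) mod M) − M) = Σ_{x ∈ x} (2·(t·x mod M) − M) = 2·wt(t, x) − |x|·M (by multiset induction; the
  pointwise identity for a singleton {x} by the three cases 2x < M, 2x = M, 2x > M — the unit t gives
  (t·(M − x)) mod M = M − (t·x mod M) (`mul_sub_mod`), and t·(M/2) ≡ M/2 for an even M (`mul_half_mod`), so the absent
  coordinate M/2 contributes 0 on both sides);
* `conMat_mulVec_oddVec` — A HODGE MULTISET'S ODD VECTOR SATISFIES EVERY WEIGHT CONSTRAINT (the page's Lemma 1 in its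
  lattice form): conMat M unitsF *ᵥ s(m) = 0 for every family of units;
* `checkSH` / `sigma_isHodge_of_check` / `isHodge_of_isBlock` — every block is a Hodge multiset: the 4- and split
  6-multisets by definition, the σ_{p,i} by a kernel enumeration per degree (`checkSH M = true`, the shape of `checkS`);
* `span_le_ker` — L_M ≤ H_M;
* `relindex_eq_two` — THE INDEX AS AN INDEX: if L ≤ H, H ⊓ L = H ⊓ {χ even} and H has a vector of odd parity, then
  `L.toAddSubgroup.relIndex H.toAddSubgroup = 2` (Mathlib's `AddSubgroup.relIndex`: the functional s ↦ φ_χ(s) mod 2 maps H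
  onto ℤ/2 with kernel L, `AddSubgroup.relIndex_ker`); `two_cosets` — the same in the two-coset form.
The per-degree corollaries (`checkSH_M`, `L_le_H_M`, `L_eq_M`, `relindex_M`, `cosets_M` at the thirty degrees) are in
lean/P1LatticeIndexTwoExactIndexA.lean (33 … 87) and lean/P1LatticeIndexTwoExactIndexB.lean (88 … 119).
NOT formalised: claim(·) for the blocks (Shioda 1981 Thm 4.3 / Lefschetz (1,1), Aoki 1987 Thm 2-1 / Thm 1-4); the general
statement that Aoki's σ_{p,i} are Hodge multisets (here per degree by enumeration); anything Hodge-theoretic.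
Nothing here asserts anything about whether the statement of README §1 has been proved elsewhere.
-/

namespace HodgeRepro0.P1.P1LatticeIndexTwoExact
open Matrix

/-- the odd vector of a singleton -/
theorem oddVec_singleton {n : ℕ} (M x : ℕ) (a : Fin n) :
    oddVec M ({x} : Multiset ℕ) a =
      (if a.val + 1 = x then (1 : ℤ) else 0) - (if M - (a.val + 1) = x then (1 : ℤ) else 0) := by
  simp only [oddVec, Multiset.count_singleton]
  split_ifs <;> simp_all

/-- the sum of an indicator at a coordinate in range -/
theorem sum_ind_of_lt {n : ℕ} (v : Fin n → ℤ) (i : ℕ) (hi : i < n) :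
    ∑ a : Fin n, (if a.val = i then v a else 0) = v ⟨i, hi⟩ := by
  rw [Finset.sum_eq_single ⟨i, hi⟩]
  · simp
  · intro b _ hb
    rw [if_neg]
    intro h
    exact hb (Fin.ext h)
  · intro h
    exact absurd (Finset.mem_univ _) h

/-- the sum of an indicator at a coordinate out of range -/
theorem sum_ind_of_not_lt {n : ℕ} (v : Fin n → ℤ) (i : ℕ) (hi : ¬ i < n) :
    ∑ a : Fin n, (if a.val = i then v a else 0) = 0 := by
  apply Finset.sum_eq_zero
  intro a _
  rw [if_neg]
  intro h
  exact hi (h ▸ a.isLt)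

/-- the weight vector of the unit t at M on the coordinates a < n: 2·(t·(a+1) mod M) − M -/
def wvec (M t : ℕ) {n : ℕ} : Fin n → ℤ := fun a => 2 * (((t * (a.val + 1)) % M : ℕ) : ℤ) - (M : ℤ)

/-- f_t(x) = 2·(t·x mod M) − M -/
def fval (M t x : ℕ) : ℤ := 2 * (((t * x) % M : ℕ) : ℤ) - (M : ℤ)

/-- a unit t and 0 < x < M: t·x is not divisible by M -/
theorem mul_mod_pos (M t x : ℕ) (ht : Nat.gcd t M = 1) (hx : 0 < x ∧ x < M) : 0 < (t * x) % M := by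
  rcases Nat.eq_zero_or_pos ((t * x) % M) with h | h
  · exfalso
    have hdvd : M ∣ t * x := Nat.dvd_of_mod_eq_zero h
    have hcop : Nat.Coprime M t := by
      rw [Nat.coprime_comm]
      exact ht
    have := hcop.dvd_of_dvd_mul_left hdvd
    have := Nat.le_of_dvd hx.1 this
    omega
  · exact h

/-- a unit t and 0 < x < M: (t·(M − x)) mod M = M − (t·x mod M) -/
theorem mul_sub_mod (M t x : ℕ) (ht : Nat.gcd t M = 1) (hx : 0 < x ∧ x < M) :
    (t * (M - x)) % M = M - (t * x) % M := by
  have hA := mul_mod_pos M t x ht hx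
  have hAlt : (t * x) % M < M := Nat.mod_lt _ (by omega)
  have hBlt : (t * (M - x)) % M < M := Nat.mod_lt _ (by omega)
  have hsum : ((t * x) % M + (t * (M - x)) % M) % M = 0 := by
    rw [← Nat.add_mod, ← Nat.mul_add, Nat.add_sub_cancel' hx.2.le, Nat.mul_mod_left]
  have := sum_eq_of_mod M ((t * x) % M + (t * (M - x)) % M) (by omega) (by omega) hsum
  omega

/-- a unit t of an even M = 2x: (t·x) mod M = x -/
theorem mul_half_mod (M t x : ℕ) (ht : Nat.gcd t M = 1) (hM : M = 2 * x) (hx : 0 < x) : (t * x) % M = x := by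
  have hodd : t % 2 = 1 := by
    rcases Nat.mod_two_eq_zero_or_one t with h | h
    · exfalso
      have h2t : 2 ∣ t := Nat.dvd_of_mod_eq_zero h
      have h2M : 2 ∣ M := ⟨x, hM⟩
      have := Nat.dvd_gcd h2t h2M
      rw [ht] at this
      exact absurd this (by decide)
    · exact h
  have ht' : t = 2 * (t / 2) + 1 := by omega
  rw [ht', hM]
  have : (2 * (t / 2) + 1) * x = x + (t / 2) * (2 * x) := by ring
  rw [this, Nat.add_mul_mod_self_right]
  exact Nat.mod_eq_of_lt (by omega)

/-- THE POINTWISE IDENTITY: for 0 < x < M, a unit t and n = ⌊(M−1)/2⌋, the odd vector of {x} paired with the weight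
vector of t is f_t(x) = 2·(t·x mod M) − M (the three cases 2x < M, 2x = M, 2x > M; the coordinate M/2 of an even M is
absent on both sides: the odd vector of {M/2} is 0 and t·(M/2) ≡ M/2) -/
theorem pointwise {n : ℕ} (M t : ℕ) (hn : n = (M - 1) / 2) (ht : Nat.gcd t M = 1) (x : ℕ) (hx : 0 < x ∧ x < M) :
    ∑ a : Fin n, oddVec M ({x} : Multiset ℕ) a * wvec M t a = fval M t x := by
  have e : ∀ a : Fin n, oddVec M ({x} : Multiset ℕ) a * wvec M t a =
      (if a.val = x - 1 then wvec M t a else 0) - (if a.val = M - x - 1 then wvec M t a else 0) := by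
    intro a
    rw [oddVec_singleton]
    have ha : a.val < n := a.isLt
    have h1 : (a.val + 1 = x) ↔ (a.val = x - 1) := by omega
    have h2 : (M - (a.val + 1) = x) ↔ (a.val = M - x - 1) := by omega
    simp only [h1, h2]
    split_ifs <;> ring
  simp only [e, Finset.sum_sub_distrib]
  rcases Nat.lt_trichotomy (2 * x) M with h | h | h
  · -- 2x < M: the first indicator lands at the coordinate x − 1, the second is out of range
    rw [sum_ind_of_lt (wvec M t) (x - 1) (by omega), sum_ind_of_not_lt (wvec M t) (M - x - 1) (by omega)]
    simp only [wvec, fval, sub_zero]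
    have : x - 1 + 1 = x := by omega
    rw [this]
  · -- 2x = M: both indicators are out of range, and f_t(M/2) = 0
    rw [sum_ind_of_not_lt (wvec M t) (x - 1) (by omega), sum_ind_of_not_lt (wvec M t) (M - x - 1) (by omega)]
    simp only [fval, sub_zero]
    rw [mul_half_mod M t x ht h.symm hx.1]
    omega
  · -- 2x > M: the first indicator is out of range, the second lands at the coordinate M − x − 1
    rw [sum_ind_of_not_lt (wvec M t) (x - 1) (by omega), sum_ind_of_lt (wvec M t) (M - x - 1) (by omega)]
    simp only [wvec, fval, zero_sub]
    have e1 : M - x - 1 + 1 = M - x := by omega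
    rw [e1, mul_sub_mod M t x ht hx]
    have hAlt : (t * x) % M ≤ M := (Nat.mod_lt _ (by omega)).le
    rw [Nat.cast_sub hAlt]
    ring

/-- THE WEIGHT IDENTITY: for a multiset m of entries in [1, M−1], a unit t and n = ⌊(M−1)/2⌋,
Σₐ s(m)ₐ·(2·(t·(a+1) mod M) − M) = Σ_{x ∈ m} (2·(t·x mod M) − M) -/
theorem sum_oddVec_mul_wvec {n : ℕ} (M t : ℕ) (hn : n = (M - 1) / 2) (ht : Nat.gcd t M = 1) (m : Multiset ℕ)
    (hm : ∀ x ∈ m, 0 < x ∧ x < M) :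
    ∑ a : Fin n, oddVec M m a * wvec M t a = (m.map (fval M t)).sum := by
  induction m using Multiset.induction_on with
  | empty => simp [oddVec]
  | cons x m ih =>
    have hx := hm x (Multiset.mem_cons_self x m)
    have hm' : ∀ y ∈ m, 0 < y ∧ y < M := fun y hy => hm y (Multiset.mem_cons_of_mem hy)
    rw [Multiset.map_cons, Multiset.sum_cons, ← ih hm', ← pointwise M t hn ht x hx, ← Finset.sum_add_distrib]
    apply Finset.sum_congr rfl
    intro a _
    rw [← add_mul, ← Multiset.singleton_add, oddVec_add]
    rfl

/-- the right-hand side of the weight identity is 2·wt(t, m) − |m|·M -/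
theorem sum_map_fval (M t : ℕ) (m : Multiset ℕ) :
    (m.map (fval M t)).sum = 2 * (wt M t m : ℤ) - (Multiset.card m : ℤ) * (M : ℤ) := by
  simp only [fval, wt, Multiset.sum_map_sub, Multiset.sum_map_mul_left, Multiset.map_const', Multiset.sum_replicate,
    Nat.cast_multiset_sum, Multiset.map_map, Function.comp_def, nsmul_eq_mul]

/-- A HODGE MULTISET'S ODD VECTOR SATISFIES EVERY WEIGHT CONSTRAINT: for n = ⌊(M−1)/2⌋ and any family of units
`unitsF`, conMat M unitsF *ᵥ s(m) = 0 — i.e. s(m) ∈ H_M (the page's Lemma 1 in its lattice form) -/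
theorem conMat_mulVec_oddVec {n u : ℕ} (M : ℕ) (hn : n = (M - 1) / 2) (unitsF : Fin u → ℕ)
    (hU : ∀ i, unitsF i < M ∧ Nat.gcd (unitsF i) M = 1) (m : Multiset ℕ) (hm : IsHodge M m) :
    conMat (n := n) M unitsF *ᵥ oddVec (n := n) M m = 0 := by
  funext i
  simp only [Matrix.mulVec, dotProduct, conMat, Matrix.of_apply, Pi.zero_apply]
  have h1 := sum_oddVec_mul_wvec (n := n) M (unitsF i) hn (hU i).2 m hm.2.1
  rw [sum_map_fval] at h1
  have h2 : ∑ a : Fin n, (2 * (((unitsF i * (a.val + 1)) % M : ℕ) : ℤ) - (M : ℤ)) * oddVec M m a =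
      ∑ a : Fin n, oddVec M m a * wvec M (unitsF i) a := by
    apply Finset.sum_congr rfl
    intro a _
    simp only [wvec]
    ring
  rw [h2, h1]
  have h3 := hm.2.2 (unitsF i) (hU i).1 (hU i).2
  have h4 : ((2 * wt M (unitsF i) m : ℕ) : ℤ) = ((Multiset.card m * M : ℕ) : ℤ) := by exact_mod_cast h3
  push_cast at h4
  linarith

/-- THE σ-HODGE CHECK: every σ_{p,i} of the block set of level M passes the Hodge test (the shape of `checkS`) -/
def checkSH (M : ℕ) : Bool :=
  (List.range (M + 1)).all fun p => !(decide (Nat.Prime p) && p % 2 == 1 && M % p == 0) ||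
    (List.range M).all fun i => i == 0 || !(decide (2 < (M / p) / Nat.gcd i (M / p))) ||
      isHodge M (unitsL M) (sigma M p i)

/-- the check passed ⇒ every σ_{p,i} of the block set is a Hodge multiset -/
theorem sigma_isHodge_of_check (M : ℕ) (h : checkSH M = true) (p i : ℕ) (hp : Nat.Prime p) (hodd : p % 2 = 1)
    (hdvd : M % p = 0) (hi0 : 0 < i) (hiM : i < M) (hg : 2 < (M / p) / Nat.gcd i (M / p)) :
    IsHodge M ((sigma M p i : List ℕ) : Multiset ℕ) := by
  simp only [checkSH, List.all_eq_true, List.mem_range, Bool.or_eq_true, Bool.not_eq_true', beq_iff_eq,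
    decide_eq_false_iff_not] at h
  have hpM : p < M + 1 := by
    have := Nat.le_of_dvd (by omega) (Nat.dvd_of_mod_eq_zero hdvd)
    omega
  have h1 := h p hpM
  rcases h1 with h1 | h1
  · simp [hp, hodd, hdvd] at h1
  · have h2 := h1 i hiM
    rcases h2 with (h2 | h2) | h2
    · omega
    · exact absurd hg h2
    · exact (isHodge_iff M _).mp h2

/-- EVERY BLOCK IS A HODGE MULTISET (the page's Lemma 1 (b) at the level M): the 4- and split 6-multisets by definition,
the σ's by the check -/
theorem isHodge_of_isBlock (M : ℕ) (h : checkSH M = true) (m : Multiset ℕ) (hm : IsBlock M m) : IsHodge M m := by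
  rcases hm with ⟨_, hH⟩ | ⟨T₁, T₂, rfl, _, _, _, _, hH⟩ | ⟨p, i, hp, hodd, hdvd, hi0, hiM, hg, rfl⟩
  · exact hH
  · exact hH
  · exact sigma_isHodge_of_check M h p i hp hodd hdvd hi0 hiM hg

/-- the rows of a listed unit family are units: from `List.ofFn unitsF = UL` and `UL = unitsL M` -/
theorem units_ok_of_lists {u : ℕ} (M : ℕ) (unitsF : Fin u → ℕ) (UL : List ℕ) (h1 : List.ofFn unitsF = UL)
    (h2 : UL = unitsL M) (i : Fin u) : unitsF i < M ∧ Nat.gcd (unitsF i) M = 1 := by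
  have hmem : unitsF i ∈ List.ofFn unitsF := List.mem_ofFn.mpr ⟨i, rfl⟩
  rw [h1, h2, mem_unitsL] at hmem
  exact hmem

/-- L_M ⊆ H_M: the ℤ-span of the odd vectors of all blocks lies in the kernel of the weight constraints -/
theorem span_le_ker {n u : ℕ} (M : ℕ) (hn : n = (M - 1) / 2) (unitsF : Fin u → ℕ)
    (hU : ∀ i, unitsF i < M ∧ Nat.gcd (unitsF i) M = 1) (hB : ∀ m, IsBlock M m → IsHodge M m) :
    Submodule.span ℤ ((oddVec (n := n) M) '' {m | IsBlock M m}) ≤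
      LinearMap.ker (Matrix.mulVecLin (conMat (n := n) M unitsF)) := by
  rw [Submodule.span_le]
  rintro _ ⟨m, hm, rfl⟩
  rw [SetLike.mem_coe, LinearMap.mem_ker, Matrix.mulVecLin_apply]
  exact conMat_mulVec_oddVec M hn unitsF hU m (hB m hm)

/-- the functional mod 2, as an additive homomorphism to ℤ/2 -/
def phiMod2 {n : ℕ} (chi : Fin n → ℤ) : (Fin n → ℤ) →+ ZMod 2 :=
  (Int.castAddHom (ZMod 2)).comp (phi chi).toAddMonoidHom

/-- the functional mod 2, unfolded -/
theorem phiMod2_apply {n : ℕ} (chi : Fin n → ℤ) (s : Fin n → ℤ) : phiMod2 chi s = ((phi chi s : ℤ) : ZMod 2) := rfl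

/-- the kernel of the functional mod 2 is the even-parity sublattice -/
theorem ker_phiMod2 {n : ℕ} (chi : Fin n → ℤ) :
    (phiMod2 chi).ker = (Submodule.comap (phi chi) (Ideal.span {(2 : ℤ)})).toAddSubgroup := by
  ext s
  rw [AddMonoidHom.mem_ker, phiMod2_apply, Submodule.mem_toAddSubgroup, Submodule.mem_comap, Ideal.mem_span_singleton,
    ZMod.intCast_zmod_eq_zero_iff_dvd]
  simp

/-- THE INDEX AS AN INDEX: if L ≤ H, H ⊓ L is the even-parity part of H and H has a vector of odd parity, then
[H : L] = 2 — Mathlib's `AddSubgroup.relIndex` of the additive groups: the functional mod 2 maps H onto ℤ/2 with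
kernel L -/
theorem relindex_eq_two {n : ℕ} (chi : Fin n → ℤ) (H L : Submodule ℤ (Fin n → ℤ)) (hLH : L ≤ H)
    (hL : H ⊓ L = H ⊓ Submodule.comap (phi chi) (Ideal.span {(2 : ℤ)}))
    (v : Fin n → ℤ) (hv : v ∈ H) (hodd : phi chi v % 2 = 1) :
    L.toAddSubgroup.relIndex H.toAddSubgroup = 2 := by
  have hL' : L.toAddSubgroup = (phiMod2 chi).ker ⊓ H.toAddSubgroup := by
    rw [ker_phiMod2]
    ext s
    simp only [AddSubgroup.mem_inf, Submodule.mem_toAddSubgroup]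
    constructor
    · intro hs
      have h : s ∈ H ⊓ L := ⟨hLH hs, hs⟩
      rw [hL] at h
      exact ⟨h.2, h.1⟩
    · rintro ⟨h1, h2⟩
      have h : s ∈ H ⊓ Submodule.comap (phi chi) (Ideal.span {(2 : ℤ)}) := ⟨h2, h1⟩
      rw [← hL] at h
      exact h.2
  rw [hL', AddSubgroup.inf_relIndex_right, AddSubgroup.relIndex_ker]
  have himg : AddSubgroup.map (phiMod2 chi) H.toAddSubgroup = ⊤ := by
    rw [AddSubgroup.eq_top_iff']
    intro z
    rw [AddSubgroup.mem_map]
    have hz : z = 0 ∨ z = 1 := by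
      revert z
      decide
    rcases hz with rfl | rfl
    · exact ⟨0, H.toAddSubgroup.zero_mem, map_zero _⟩
    · refine ⟨v, hv, ?_⟩
      rw [phiMod2_apply]
      have h2 : phi chi v = 2 * (phi chi v / 2) + 1 := by omega
      rw [h2]
      push_cast
      have h0 : (2 : ZMod 2) = 0 := by decide
      rw [h0, zero_mul, zero_add]
  rw [himg, AddSubgroup.card_top, Nat.card_zmod]

/-- the two-coset form of the index: every s ∈ H lies in L or in v + L -/
theorem two_cosets {n : ℕ} (chi : Fin n → ℤ) (H L : Submodule ℤ (Fin n → ℤ))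
    (hL : H ⊓ L = H ⊓ Submodule.comap (phi chi) (Ideal.span {(2 : ℤ)}))
    (v : Fin n → ℤ) (hv : v ∈ H) (hodd : phi chi v % 2 = 1) (s : Fin n → ℤ) (hs : s ∈ H) :
    s ∈ L ∨ s - v ∈ L := by
  have key : ∀ w ∈ H, phi chi w % 2 = 0 → w ∈ L := by
    intro w hw hpar
    have h : w ∈ H ⊓ Submodule.comap (phi chi) (Ideal.span {(2 : ℤ)}) :=
      Submodule.mem_inf.mpr ⟨hw, by rw [Submodule.mem_comap, Ideal.mem_span_singleton]; exact Int.dvd_of_emod_eq_zero hpar⟩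
    rw [← hL] at h
    exact h.2
  rcases Int.emod_two_eq_zero_or_one (phi chi s) with h | h
  · exact Or.inl (key s hs h)
  · refine Or.inr (key (s - v) (H.sub_mem hs hv) ?_)
    rw [map_sub]
    omega

end HodgeRepro0.P1.P1LatticeIndexTwoExact
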